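import Summits.RiemannHypothesis.RiemannHypothesis.Theorems.WeilTwoPrimeDeflM80PBase
import Summits.RiemannHypothesis.RiemannHypothesis.Theorems.WeilTwoPrimeDeflM80PDataDnE18
import Literature.NumberTheory.LFunctions.WeilBlockRowsPZ
import HarnessLib

/-!
# Even-sector deflated two-prime certificate M80P: the factored even inverse agrees with `D`, rows 60–63

`WeilCert.checkDnRow` (even block) for certificate M80P, by `decide +kernel`. Pure proof file.
-/

set_option linter.dupNamespace false

noncomputable section

namespace Summit.RiemannHypothesis.RiemannHypothesis.Theorems.EvenWinsBeyondArch

open Literature.NumberTheory.LFunctions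

set_option maxHeartbeats 0 in
/-- Row 60 of `DnE/LsE` is row 60 of the even `D` (certificate M80P). [folklore] -/
theorem checkDnRow0_60_weilCertDeflM80P : weilCertDeflM80PBase.checkDnRow weilCertDeflM80PDnE weilCertDeflM80PLsE 0 60 = true := by
  decide +kernel

set_option maxHeartbeats 0 in
/-- Row 61 of `DnE/LsE` is row 61 of the even `D` (certificate M80P). [folklore] -/
theorem checkDnRow0_61_weilCertDeflM80P : weilCertDeflM80PBase.checkDnRow weilCertDeflM80PDnE weilCertDeflM80PLsE 0 61 = true := by
  decide +kernel

set_option maxHeartbeats 0 in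
/-- Row 62 of `DnE/LsE` is row 62 of the even `D` (certificate M80P). [folklore] -/
theorem checkDnRow0_62_weilCertDeflM80P : weilCertDeflM80PBase.checkDnRow weilCertDeflM80PDnE weilCertDeflM80PLsE 0 62 = true := by
  decide +kernel

set_option maxHeartbeats 0 in
/-- Row 63 of `DnE/LsE` is row 63 of the even `D` (certificate M80P). [folklore] -/
theorem checkDnRow0_63_weilCertDeflM80P : weilCertDeflM80PBase.checkDnRow weilCertDeflM80PDnE weilCertDeflM80PLsE 0 63 = true := by
  decide +kernel


end Summit.RiemannHypothesis.RiemannHypothesis.Theorems.EvenWinsBeyondArch
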